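import Mathlib.MeasureTheory.Function.StronglyMeasurable.AEStronglyMeasurable
import Mathlib.MeasureTheory.Function.LocallyIntegrable
import Mathlib.MeasureTheory.Integral.Prod
import Mathlib.Analysis.InnerProductSpace.Laplacian
import Mathlib.Analysis.Calculus.Deriv.Basic
import Literature.Analysis.FunctionSpaces.SobolevDomain
import Literature.Analysis.FunctionSpaces.TorusCalculus
import Literature.Analysis.FunctionSpaces.TorusTestFunction
import Literature.Analysis.FunctionSpaces.TorusFluidGlue
import Literature.Analysis.FluidPDE.VectorCalculus
import Literature.Analysis.FluidPDE.ClassicalSolution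
import HarnessLib

-- provenance: harness21/H21/H21/Prelude/FluidKinetic/WeakSolution.lean @ 2b5b74a (interim HEAD d8f2665); M5 mechanical rewrite
/-!
# Weak and distributional solutions of the incompressible Navier–Stokes / Euler equations

Trunk: FluidKinetic (outline `H21/Outlines/FluidKinetic.md`, item F4 `WeakSolution`; notions
`weak_solution_ns`, `weak_euler_solution`).

Let `E` be a finite-dimensional real inner product space (physical space; `ℝ³` in the Clay
statements) with its Lebesgue measure `volume`. This file provides the two standard weak
formulations of the forced incompressible Navier–Stokes system
`∂ₜu + (u·∇)u + ∇p = νΔu + f`, `div u = 0` (Euler: `ν = 0`):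

* **pressure-free, with initial datum** (`Literature.Fluid.IsWeakNSSolutionOn T ν f u₀ u`, Leray 1934,
  (17) p. 206 and §III; Buckmaster–Vicol 2019, Def. 1.1; De Lellis–Székelyhidi 2009, §1; Temam,
  Ch. III §1.1 (1.22)–(1.23)): `u ∈ L²_loc([0,T) × E)`, weakly divergence free for a.e. `t`, and
  for every smooth compactly supported *divergence-free* vector test field `ψ` on `(-∞, T) × E`
  `∫₀ᵀ ∫ (⟪u, ∂ₜψ⟫ + ⟪u, (u·∇)ψ⟫ + ν ⟪u, Δψ⟫ + ⟪f, ψ⟫) dx dt + ∫ ⟪u₀, ψ(0)⟫ dx = 0`;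
* **pressure-explicit, on a space–time domain `Q`** (`Literature.Fluid.IsDistributionalNSSolutionOn Q ν
  f u p`, Caffarelli–Kohn–Nirenberg 1982, (2.1)–(2.2), (2.5)): `u, |u|², p ∈ L¹_loc(Q)`, `u` weakly
  divergence free in `Q`, and for *every* smooth compactly supported vector test field `ψ` on `Q`
  `∫∫_Q (⟪u, ∂ₜψ⟫ + ⟪u, (u·∇)ψ⟫ + ν ⟪u, Δψ⟫ + p div ψ + ⟪f, ψ⟫) = 0`.

The torus side (namespace `Literature.Torus`, extending the accepted G03 file `TorusFluidGlue`) adds the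
forced pressure-free predicate `Torus.IsWeakNSSolutionForcedOn T ν f u₀ u` (G03's
`Torus.IsWeakNSSolutionWithDataOn` is the case `f = 0`, `isWeakNSSolutionForcedOn_zero_iff`) and
the pressure-explicit `Torus.IsDistributionalNSSolutionOn T ν f u p`.

## Main definitions

* `Literature.Fluid.slab I hI : Opens (ℝ × X)`: the open space–time slab `I × X` over an open time set.
* `Literature.Fluid.IsSpaceTimeTestOn Q ψ := IsTestFunctionOn Q (uncurry ψ)`: space–time test fields are
  the accepted G03 test functions (`Literature.Analysis.FunctionSpaces.IsTestFunctionOn`, `SobolevDomain`) of the uncurried field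
  — nothing is redefined.
* `Literature.Fluid.timeDeriv ψ t x = deriv (ψ · x) t`: the two-sided time derivative (for test fields,
  which live on all of `ℝ`; twin of `Literature.Analysis.FunctionSpaces.Torus.timeDeriv`).
* `Literature.Analysis.FluidPDE.IsWeakNSSolutionOn`, `Literature.Analysis.FluidPDE.IsWeakEulerSolutionOn`,
  `Literature.Analysis.FluidPDE.IsDistributionalNSSolutionOn`, `Literature.Analysis.FluidPDE.IsDistributionalEulerSolutionOn`.
* `Literature.Analysis.FluidPDE.Torus.IsWeakNSSolutionForcedOn`, `Literature.Analysis.FluidPDE.Torus.IsDistributionalNSSolutionOn`.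

## Mathlib search

Mathlib (this pin) has no Navier–Stokes/Euler notions (searched `NavierStokes`, `Euler` in
`Analysis/`, `weak solution`, `Leray`: none). It has bundled test functions/distributions
(`Mathlib/Analysis/Distribution/`, `𝓓(Ω, G)`), bridged to `Literature.Analysis.FunctionSpaces.IsTestFunctionOn` by the accepted
`TestFunction.isTestFunctionOn`; all weak formulations here are explicit integral identities
(G03 contract). Used from Mathlib: `AEStronglyMeasurable`, `Measure.restrict`, `lintegral`,
Bochner `integral` (iterated `∫ t in Ioo 0 T, ∫ x, …` and product `∫ z in ↑Q, …` on `ℝ × E` with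
`volume = volume.prod volume`), `LocallyIntegrableOn`, `deriv`, `gradient`,
`Laplacian.laplacian` (`Δ`), `TopologicalSpace.Opens`.

## Design notes

* Only the `Laplacian` scope is opened for `Δ`; smoothness exponents are hidden in
  `IsTestFunctionOn` (`∞` would clash with `ENNReal`).
* The E-side weak identity uses iterated integrals `∫ t in Ioo 0 T, ∫ x, …` exactly like the
  accepted torus predicates; the pressure-explicit predicate on a general open `Q ⊆ ℝ × E`
  integrates over `Q` for the product measure (CKN (2.2) `∫∫_Q`).
* Local square integrability *up to the time boundary* is `∀ K compact, ∫⁻_{(0,T)×K} ‖u‖ₑ² < ∞`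
  (Leray's `u ∈ L²_loc`; BV Def. 1.1 has global `L²`, which is the torus version).
* Mean zero on the torus is not imposed (G03 convention, documented there).
* `Torus.exists_pressure_of_isWeakNSSolutionForcedOn` is stated under an `L^{2q}`, `q > 1`,
  integrability hypothesis on `u` (and `L^q` on `f`) so that the pressure
  `p = (−Δ)⁻¹ div div (u ⊗ u) − (−Δ)⁻¹ div f` is an `L^q ⊆ L¹` *function* (Calderón–Zygmund on
  `T^d`); for merely `L²` velocities the pressure is only a distribution.

## Retired / corrected named facts (verdict clean-up, 2026-08-15)

Two named facts formerly stated in this file were found, by their tenured prove-seats, to be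
undischargeable *as stated*; both have corrected statements, vendored and **proved** in the
proofs files that import this one, and the old `def`s are no longer declared here:

* `IsDistributionalNSSolutionOn.isWeakNSSolutionOn_of` ("dropping the pressure",
  Caffarelli–Kohn–Nirenberg 1982, §2) — **refuted as stated**: it quantified over an arbitrary
  datum `u₀ : E → E` constrained only through the lower Lebesgue integrals
  `∫⁻ x in K, ‖u t x - u₀ x‖ₑ ^ 2`, which do not see a non-measurable perturbation `𝟙_A w` of
  the datum (`A` of inner measure zero), whereas the Bochner pairing `∫ ⟪u₀, ψ 0⟫` of the
  conclusion does; sorry-free counterexample on `ℝ³`: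
  `IsDistributionalNSSolutionOn.not_forall_isWeakNSSolutionOn_of`
  (`Literature/Analysis/FluidPDE/DistributionalToWeakCounterexample.lean`, where the retired
  statement is written out in full). Corrected statement (one extra hypothesis,
  `AEStronglyMeasurable u₀ volume` — the datum of every printed source is an `L²_loc` field,
  Robinson–Rodrigo–Sadowski 2016, Def. 3.3: `u₀ ∈ H`), proved:
  `IsDistributionalNSSolutionOn.isWeakNSSolutionOn_of_aestronglyMeasurable` (`…_holds`, usable form
  `IsDistributionalNSSolutionOn.isWeakNSSolutionOn_datum`) in
  `Literature/Analysis/FluidPDE/DistributionalToWeak.lean`.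
* `Torus.IsWeakNSSolutionForcedOn.lift` (torus-to-space bridge) — **mis-stated** (stronger than
  every source): it carried no hypothesis on the force `f` and the datum `u₀`, which the torus
  predicate leaves completely free (they enter only through Bochner pairings), whereas Leray 1934,
  §31, (5.15) has `f = 0`, `u₀ ∈ L²`, Temam, Ch. III §1.1 has `f ∈ L²(0,T;V')`, `u₀ ∈ H`, and
  Buckmaster–Vicol 2019, Def. 1.1 has `f = 0`; the unfolding `∫_{ℝ^d} g = ∫_{T^d} ∑ₖ g(· + k)`
  behind the bridge needs exactly `f t ∈ L¹(T^d)` (a.e. `t`) and `u₀ ∈ L¹(T^d)`. Corrected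
  statement, proved: `Torus.IsWeakNSSolutionForcedOn.lift_of_integrable` (`…_holds`) in
  `Literature/Analysis/FluidPDE/WeakSolutionLift.lean` (the old def had no users).

## References

* J. Leray, *Sur le mouvement d'un liquide visqueux emplissant l'espace*, Acta Math. 63 (1934),
  (17) p. 206, §§III–IV.
* T. Buckmaster, V. Vicol, *Nonuniqueness of weak solutions to the Navier–Stokes equation*, Ann.
  of Math. 189 (2019), Def. 1.1.
* L. Caffarelli, R. Kohn, L. Nirenberg, *Partial regularity of suitable weak solutions of the
  Navier–Stokes equations*, CPAM 35 (1982), (2.1)–(2.5).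
* C. De Lellis, L. Székelyhidi Jr., *The Euler equations as a differential inclusion*, Ann. of
  Math. 170 (2009), §1.
* R. Temam, *Navier–Stokes Equations* (3rd ed., 1984), Ch. III §1.1, (1.22)–(1.23); Ch. III §1.5
  and Ch. I Prop. 1.1–1.2 (recovery of the pressure, de Rham).
* J. C. Robinson, J. L. Rodrigo, W. Sadowski, *The three-dimensional Navier–Stokes equations*
  (CUP 2016), Def. 3.3, Ch. 5 (the pressure).
-/

noncomputable section

open MeasureTheory TopologicalSpace Set Function
open scoped Laplacian InnerProductSpace RealInnerProductSpace ENNReal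

namespace Literature.Analysis.FluidPDE

/-! ### Space–time slabs, test fields and the two-sided time derivative -/

section Slab

variable {X : Type*} [TopologicalSpace X]

variable (X) in
/-- The open space–time slab `I × X ⊆ ℝ × X` over an open set of times `I` (e.g. `Iio T`,
`Ioo 0 T`, `Ioi 0`), as an element of `Opens (ℝ × X)`; the domain of the space–time test fields
of Leray 1934, (17) (`I = ℝ`) and Buckmaster–Vicol 2019, Def. 1.1 (`I = (-∞, T)`). The space
`X` is explicit since it cannot be inferred from `I`. [cite: Leray1934, (17] -/
def slab (I : Set ℝ) (hI : IsOpen I) : Opens (ℝ × X) :=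
  ⟨I ×ˢ univ, hI.prod isOpen_univ⟩

/-- The underlying set of `slab X I hI` is `I ×ˢ univ`. [folklore] -/
@[simp]
theorem coe_slab (I : Set ℝ) (hI : IsOpen I) : ((slab X I hI : Opens (ℝ × X)) : Set (ℝ × X)) =
    I ×ˢ univ :=
  rfl

/-- Membership in a slab is membership of the time coordinate in `I`. [folklore] -/
@[simp]
theorem mem_slab {I : Set ℝ} {hI : IsOpen I} {z : ℝ × X} : z ∈ slab X I hI ↔ z.1 ∈ I := by
  change z ∈ I ×ˢ (univ : Set X) ↔ _
  simp

/-- Slabs are monotone in the time set. [folklore] -/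
theorem slab_mono {I J : Set ℝ} {hI : IsOpen I} {hJ : IsOpen J} (h : I ⊆ J) :
    slab X I hI ≤ slab X J hJ :=
  fun _ hz => mem_slab.2 (h (mem_slab.1 hz))

end Slab

section SpaceTime

variable {X : Type*} [NormedAddCommGroup X] [NormedSpace ℝ X]
variable {F : Type*} [NormedAddCommGroup F] [NormedSpace ℝ F]

/-- Space–time test fields on an open set `Q ⊆ ℝ × X`: `ψ : ℝ → X → F` (time first) whose
uncurried field `(t, x) ↦ ψ t x` is a test function on `Q` in the sense of the accepted
`Literature.Analysis.FunctionSpaces.IsTestFunctionOn` (smooth, compactly supported, `tsupport ⊆ Q`), i.e. `ψ ∈ C_c^∞(Q; F)`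
(Leray 1934, (17); Caffarelli–Kohn–Nirenberg 1982, (2.2): "`φ` smooth with compact support in
`D`"; Buckmaster–Vicol 2019, Def. 1.1 with `Q = (-∞, T) × 𝕋³`). Nothing is redefined: this is a
reducible wrapper of the G03 predicate. [cite: Leray1934, (17] -/
abbrev IsSpaceTimeTestOn (Q : Opens (ℝ × X)) (ψ : ℝ → X → F) : Prop :=
  FunctionSpaces.IsTestFunctionOn Q (uncurry ψ)

omit [NormedAddCommGroup X] [NormedSpace ℝ X] in
/-- The (two-sided) time derivative `∂ₜ ψ (t, x) = d/ds ψ(s, x)|_{s = t}` of `ψ : ℝ → X → F`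
(Mathlib `deriv`); used for test fields, which live on all of `ℝ` in time (solutions use the
one-sided `Fluid.timeDerivWithin`). Twin of the accepted `Literature.Analysis.FunctionSpaces.Torus.timeDeriv`
(Leray 1934, (17): `∂a/∂t`). Junk value `0` where not differentiable. [cite: Leray1934, (17] -/
def timeDeriv (ψ : ℝ → X → F) (t : ℝ) (x : X) : F :=
  deriv (fun s => ψ s x) t

omit [NormedAddCommGroup X] [NormedSpace ℝ X] in
/-- Unfolding `timeDeriv`. [folklore] -/
@[simp]
theorem timeDeriv_apply (ψ : ℝ → X → F) (t : ℝ) (x : X) :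
    timeDeriv ψ t x = deriv (fun s => ψ s x) t :=
  rfl

omit [NormedAddCommGroup X] [NormedSpace ℝ X] in
/-- In the interior of the time set the one-sided and the two-sided time derivatives agree
(Mathlib `derivWithin_of_mem_nhds`). [folklore] -/
theorem timeDerivWithin_of_mem_interior {S : Set ℝ} {u : ℝ → X → F} {t : ℝ}
    (ht : t ∈ interior S) (x : X) : timeDerivWithin S u t x = timeDeriv u t x :=
  derivWithin_of_mem_nhds (mem_interior_iff_mem_nhds.1 ht)

/-- The zero field is a space–time test field on every `Q`. [folklore] -/
theorem isSpaceTimeTestOn_zero (Q : Opens (ℝ × X)) : IsSpaceTimeTestOn Q (0 : ℝ → X → F) :=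
  FunctionSpaces.isTestFunctionOn_zero Q

/-- Space–time test fields on `Q` are space–time test fields on any larger open set
(`IsTestFunctionOn.mono`). [folklore] -/
theorem IsSpaceTimeTestOn.mono {Q Q' : Opens (ℝ × X)} {ψ : ℝ → X → F}
    (hψ : IsSpaceTimeTestOn Q ψ) (h : Q ≤ Q') : IsSpaceTimeTestOn Q' ψ :=
  FunctionSpaces.IsTestFunctionOn.mono hψ h

/-- The time slices `ψ t` of a space–time test field are smooth (compose with `x ↦ (t, x)`). [folklore] -/
theorem IsSpaceTimeTestOn.contDiff_slice {Q : Opens (ℝ × X)} {ψ : ℝ → X → F}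
    (hψ : IsSpaceTimeTestOn Q ψ) (t : ℝ) : ContDiff ℝ (⊤ : ℕ∞) (ψ t) :=
  hψ.contDiff.comp (contDiff_prodMk_right t)

/-- A space–time test field vanishes at every point outside `Q` (its support lies in `Q`). [folklore] -/
theorem IsSpaceTimeTestOn.apply_eq_zero {Q : Opens (ℝ × X)} {ψ : ℝ → X → F}
    (hψ : IsSpaceTimeTestOn Q ψ) {t : ℝ} {x : X} (h : (t, x) ∉ (Q : Set (ℝ × X))) : ψ t x = 0 :=
  show uncurry ψ (t, x) = 0 from
    image_eq_zero_of_notMem_tsupport fun hz => h (hψ.tsupport_subset hz)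

end SpaceTime

/-! ### Weak (Leray–Hopf-type, pressure-free) solutions on `E × [0, T)` -/

section Weak

variable {E : Type*} [NormedAddCommGroup E] [InnerProductSpace ℝ E] [FiniteDimensional ℝ E]
  [MeasurableSpace E] [BorelSpace E]

/-- **Weak solutions** of the forced incompressible Navier–Stokes system with viscosity `ν`,
force `f` and initial datum `u₀` on `E × [0, T)`, pressure-free form tested against
divergence-free fields (Leray 1934, (17) and §III; Buckmaster–Vicol 2019, Def. 1.1 with data and
force; Temam, Ch. III §1.1, (1.22)–(1.23); De Lellis–Székelyhidi 2009, §1 for Euler):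
`u` is a.e. strongly measurable on `(0,T) × E`, locally square integrable up to the time
boundary (`∫_{(0,T) × K} ‖u‖² < ∞` for every compact `K ⊆ E`), `u(t)` is weakly divergence free
for a.e. `t ∈ (0, T)`, and for every smooth compactly supported divergence-free vector test field
`ψ` on `(-∞, T) × E`
`∫₀ᵀ ∫ (⟪u, ∂ₜψ⟫ + ⟪u, (u·∇)ψ⟫ + ν ⟪u, Δψ⟫ + ⟪f, ψ⟫) dx dt + ∫ ⟪u₀, ψ(0)⟫ dx = 0`.
The E-side twin of `Literature.Analysis.FluidPDE.Torus.IsWeakNSSolutionForcedOn` (same conjuncts, same order). [cite: Leray1934, (17] -/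
def IsWeakNSSolutionOn (T : ℝ) (ν : ℝ) (f : ℝ → E → E) (u₀ : E → E) (u : ℝ → E → E) : Prop :=
  AEStronglyMeasurable (uncurry u) (volume.restrict (Ioo 0 T ×ˢ univ)) ∧
    (∀ K : Set E, IsCompact K → ∫⁻ z in Ioo 0 T ×ˢ K, ‖uncurry u z‖ₑ ^ 2 < ∞) ∧
    (∀ᵐ t ∂(volume.restrict (Ioo 0 T)), IsWeaklyDivFree (u t)) ∧
    ∀ ψ : ℝ → E → E, IsSpaceTimeTestOn (slab E (Iio T) isOpen_Iio) ψ → (∀ t, VectorCalculus.IsDivFree (ψ t)) →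
      (∫ t in Ioo 0 T, ∫ x, (⟪u t x, timeDeriv ψ t x⟫ + ⟪u t x, convect (u t) (ψ t) x⟫ +
        ν * ⟪u t x, Δ (ψ t) x⟫ + ⟪f t x, ψ t x⟫)) + ∫ x, ⟪u₀ x, ψ 0 x⟫ = 0

/-- **Weak solutions of the incompressible Euler equations** on `E × [0, T)` with force `f` and
datum `u₀`: `IsWeakNSSolutionOn` with `ν = 0` (De Lellis–Székelyhidi 2009, §1, Def. of weak
solution; Buckmaster–Vicol 2019, §1). [cite: LellisSzekelyhidi2009, §1  Def. of weak solution] -/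
abbrev IsWeakEulerSolutionOn (T : ℝ) (f : ℝ → E → E) (u₀ : E → E) (u : ℝ → E → E) : Prop :=
  IsWeakNSSolutionOn T 0 f u₀ u

/-- **Distributional (pressure-explicit) solutions** of the forced Navier–Stokes system on an
open space–time region `Q ⊆ ℝ × E` (Caffarelli–Kohn–Nirenberg 1982, (2.1)–(2.2), (2.5);
Robinson–Rodrigo–Sadowski 2016, Def. 3.3): `u`, `|u|²` and `p` are locally integrable on `Q`,
`u` is weakly divergence free in `Q` (`∫∫_Q ⟪u, ∇ₓθ⟫ = 0` for all scalar tests `θ` on `Q`), and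
for **every** smooth compactly supported vector test field `ψ` on `Q`
`∫∫_Q (⟪u, ∂ₜψ⟫ + ⟪u, (u·∇)ψ⟫ + ν ⟪u, Δψ⟫ + p div ψ + ⟪f, ψ⟫) dx dt = 0`,
the integral being over `Q` for the product Lebesgue measure on `ℝ × E`. [cite: CaffarelliKohnNirenberg1982, (2.1] -/
def IsDistributionalNSSolutionOn (Q : Opens (ℝ × E)) (ν : ℝ) (f u : ℝ → E → E)
    (p : ℝ → E → ℝ) : Prop :=
  LocallyIntegrableOn (uncurry u) (Q : Set (ℝ × E)) volume ∧
    LocallyIntegrableOn (fun z => ‖uncurry u z‖ ^ 2) (Q : Set (ℝ × E)) volume ∧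
    LocallyIntegrableOn (uncurry p) (Q : Set (ℝ × E)) volume ∧
    (∀ θ : ℝ → E → ℝ, IsSpaceTimeTestOn Q θ →
      ∫ z in (Q : Set (ℝ × E)), ⟪u z.1 z.2, gradient (θ z.1) z.2⟫ = 0) ∧
    ∀ ψ : ℝ → E → E, IsSpaceTimeTestOn Q ψ →
      ∫ z in (Q : Set (ℝ × E)), (⟪u z.1 z.2, timeDeriv ψ z.1 z.2⟫ +
        ⟪u z.1 z.2, convect (u z.1) (ψ z.1) z.2⟫ + ν * ⟪u z.1 z.2, Δ (ψ z.1) z.2⟫ +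
        p z.1 z.2 * VectorCalculus.divergence (ψ z.1) z.2 + ⟪f z.1 z.2, ψ z.1 z.2⟫) = 0

/-- **Distributional (pressure-explicit) solutions of the Euler equations** on an open
space–time region `Q`: `IsDistributionalNSSolutionOn` with `ν = 0` (De Lellis–Székelyhidi 2009,
§1, eq. (1) in the sense of distributions). [cite: LellisSzekelyhidi2009, §1  eq. (1] -/
abbrev IsDistributionalEulerSolutionOn (Q : Opens (ℝ × E)) (f u : ℝ → E → E) (p : ℝ → E → ℝ) :
    Prop :=
  IsDistributionalNSSolutionOn Q 0 f u p

variable {T T' ν : ℝ} {f u : ℝ → E → E} {u₀ : E → E} {p : ℝ → E → ℝ}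

/-- Euler weak solutions are Navier–Stokes weak solutions with `ν = 0` (definitional). [folklore] -/
theorem isWeakEulerSolutionOn_iff :
    IsWeakEulerSolutionOn T f u₀ u ↔ IsWeakNSSolutionOn T 0 f u₀ u :=
  Iff.rfl

/-- Restriction in time: a weak solution on `[0, T)` is a weak solution on `[0, T')` for every
`T' ≤ T` (test fields supported in `(-∞, T') × E` are test fields on `(-∞, T) × E`, and the
integrand vanishes for `t ≥ T'`; Leray 1934, §III). [cite: Leray1934, §III] -/
def IsWeakNSSolutionOn.mono : Prop :=
  ∀ (h : IsWeakNSSolutionOn T ν f u₀ u) (hT : T' ≤ T),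
    IsWeakNSSolutionOn T' ν f u₀ u

/-- **Classical solutions are weak solutions.** A classical solution on a time set `S ⊇ [0, T]`
is a weak solution on `[0, T)` with datum `u 0` and the same force: pair the momentum equation
with a divergence-free test field, integrate by parts in `x` (the pressure drops out,
`∫ ⟪∇p, ψ⟫ = -∫ p div ψ = 0`; `∫ ⟪Δu, ψ⟫ = ∫ ⟪u, Δψ⟫`; `∫ ⟪(u·∇)u, ψ⟫ = -∫ ⟪u, (u·∇)ψ⟫`) and in
`t` (boundary term `∫ ⟪u(0), ψ(0)⟫`) (Leray 1934, §III, derivation of (17); Temam, Ch. III §1.1).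
Local square integrability and measurability follow from continuity on `[0, T] × E`. [cite: Leray1934, §III  derivation of (17] -/
def IsClassicalNSSolutionOn.isWeakNSSolutionOn : Prop :=
  ∀ {S : Set ℝ} (h : IsClassicalNSSolutionOn S ν f u p) (hS : Icc 0 T ⊆ S),
    IsWeakNSSolutionOn T ν f (u 0) u

/-! **Dropping the pressure** (Caffarelli–Kohn–Nirenberg 1982, §2; Robinson–Rodrigo–Sadowski 2016,
§3.1): the passage from a distributional (pressure-explicit) solution on the slab `(0, T) × E`
attaining a datum `u₀` to a weak (pressure-free) solution on `[0, T)` with datum `u₀` is the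
proved fact `IsDistributionalNSSolutionOn.isWeakNSSolutionOn_of_aestronglyMeasurable` of
`Literature/Analysis/FluidPDE/DistributionalToWeak.lean` (usable form
`IsDistributionalNSSolutionOn.isWeakNSSolutionOn_datum`). The version formerly stated here without
the measurability of `u₀`, `IsDistributionalNSSolutionOn.isWeakNSSolutionOn_of`, is false and was
retired (refutation: `IsDistributionalNSSolutionOn.not_forall_isWeakNSSolutionOn_of`,
`DistributionalToWeakCounterexample.lean`); see the module docstring. -/

/-- A weak solution on `[0, T)` with a pressure `p` making the pressure-explicit
identity hold is in particular weakly divergence free slice-wise; recorded as the projection of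
the divergence conjunct (Leray 1934, §III). [cite: Leray1934, §III] -/
theorem IsWeakNSSolutionOn.ae_isWeaklyDivFree (h : IsWeakNSSolutionOn T ν f u₀ u) :
    ∀ᵐ t ∂(volume.restrict (Ioo 0 T)), IsWeaklyDivFree (u t) :=
  h.2.2.1

/-- Restriction of the domain: a distributional solution on `Q` is one on every open `Q' ≤ Q`
(local integrability restricts, `LocallyIntegrableOn.mono_set`; test fields on `Q'` are test
fields on `Q`, and the integrals over `Q'` and `Q` of an integrand supported in `Q'` agree)
(Caffarelli–Kohn–Nirenberg 1982, §2). [cite: CaffarelliKohnNirenberg1982, §2] -/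
def IsDistributionalNSSolutionOn.mono : Prop :=
  ∀ {Q Q' : Opens (ℝ × E)} (h : IsDistributionalNSSolutionOn Q ν f u p) (hQ : Q' ≤ Q),
    IsDistributionalNSSolutionOn Q' ν f u p

end Weak

end Literature.Analysis.FluidPDE

/-! ### Torus side: forced pressure-free and pressure-explicit weak solutions on `T^d × [0, T)` -/

namespace Literature.Analysis.FluidPDE.Torus

variable {d : Type*} [Fintype d] [DecidableEq d]

/-- **Forced weak solutions with initial datum on the flat torus.** Weak (pressure-free)
solutions of Navier–Stokes with viscosity `ν`, force `f` and datum `u₀` on `T^d × [0, T)`: the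
accepted G03 predicate `Torus.IsWeakNSSolutionWithDataOn T ν u₀ u` (Temam, Ch. III §1.1,
(1.22)–(1.23); Buckmaster–Vicol 2019, Def. 1.1) with the additional force term `+ ∫∫ ⟪f, ψ⟫` in
the weak identity (Leray 1934, (17)); same measurability / `L²_{t,x}` / weak divergence
conjuncts, in the same order. `f = 0` recovers the G03 predicate
(`isWeakNSSolutionForcedOn_zero_iff`). Mean zero is not imposed (G03 convention). [cite: BuckmasterVicol2019, Def. 1.1] -/
def IsWeakNSSolutionForcedOn (T : ℝ) (ν : ℝ) (f : ℝ → UnitAddTorus d → EuclideanSpace ℝ d)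
    (u₀ : UnitAddTorus d → EuclideanSpace ℝ d) (u : ℝ → UnitAddTorus d → EuclideanSpace ℝ d) :
    Prop :=
  AEStronglyMeasurable (FunctionSpaces.Torus.stLift u) (volume.restrict (Ioo 0 T ×ˢ univ)) ∧
    (∫⁻ t in Ioo 0 T, ∫⁻ x, ‖u t x‖ₑ ^ 2 < ∞) ∧
    (∀ᵐ t ∂(volume.restrict (Ioo 0 T)), FunctionSpaces.Torus.IsWeaklyDivFree (u t)) ∧
    ∀ ψ : ℝ → UnitAddTorus d → EuclideanSpace ℝ d, FunctionSpaces.Torus.IsSpaceTimeTest T ψ → FunctionSpaces.Torus.IsDivFreeTest ψ →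
      (∫ t in Ioo 0 T, ∫ x, (⟪u t x, FunctionSpaces.Torus.timeDeriv ψ t x⟫ + ⟪u t x, FunctionSpaces.Torus.convect (u t) (ψ t) x⟫ +
        ν * ⟪u t x, FunctionSpaces.Torus.laplacian (ψ t) x⟫ + ⟪f t x, ψ t x⟫)) + ∫ x, ⟪u₀ x, ψ 0 x⟫ = 0

/-- **Distributional (pressure-explicit) solutions on the flat torus.** `(u, p)` solves the
forced Navier–Stokes system with viscosity `ν` on `T^d × (0, T)` in the sense of distributions
(Caffarelli–Kohn–Nirenberg 1982, (2.1)–(2.2) transplanted to the periodic setting;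
Robinson–Rodrigo–Sadowski 2016, Def. 3.3 and Ch. 5): `u` and `p` are a.e. strongly measurable on
`(0,T) × T^d`, `u ∈ L²_{t,x}`, `p ∈ L¹_{t,x}`, `u(t)` is weakly divergence free for a.e. `t`, and
for **every** smooth vector test field `ψ` compactly supported in time in `(0, T)`
(`Torus.IsSpaceTimeTestIoo`, not necessarily divergence free)
`∫₀ᵀ ∫ (⟪u, ∂ₜψ⟫ + ⟪u, (u·∇)ψ⟫ + ν ⟪u, Δψ⟫ + p div ψ + ⟪f, ψ⟫) dx dt = 0`. [cite: CaffarelliKohnNirenberg1982, (2.1] -/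
def IsDistributionalNSSolutionOn (T : ℝ) (ν : ℝ) (f u : ℝ → UnitAddTorus d → EuclideanSpace ℝ d)
    (p : ℝ → UnitAddTorus d → ℝ) : Prop :=
  AEStronglyMeasurable (FunctionSpaces.Torus.stLift u) (volume.restrict (Ioo 0 T ×ˢ univ)) ∧
    (∫⁻ t in Ioo 0 T, ∫⁻ x, ‖u t x‖ₑ ^ 2 < ∞) ∧
    AEStronglyMeasurable (FunctionSpaces.Torus.stLift p) (volume.restrict (Ioo 0 T ×ˢ univ)) ∧
    (∫⁻ t in Ioo 0 T, ∫⁻ x, ‖p t x‖ₑ < ∞) ∧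
    (∀ᵐ t ∂(volume.restrict (Ioo 0 T)), FunctionSpaces.Torus.IsWeaklyDivFree (u t)) ∧
    ∀ ψ : ℝ → UnitAddTorus d → EuclideanSpace ℝ d, FunctionSpaces.Torus.IsSpaceTimeTestIoo T ψ →
      ∫ t in Ioo 0 T, ∫ x, (⟪u t x, FunctionSpaces.Torus.timeDeriv ψ t x⟫ + ⟪u t x, FunctionSpaces.Torus.convect (u t) (ψ t) x⟫ +
        ν * ⟪u t x, FunctionSpaces.Torus.laplacian (ψ t) x⟫ + p t x * FunctionSpaces.Torus.divergence (ψ t) x + ⟪f t x, ψ t x⟫) = 0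

variable {T ν : ℝ} {f u : ℝ → UnitAddTorus d → EuclideanSpace ℝ d}
  {u₀ : UnitAddTorus d → EuclideanSpace ℝ d} {p : ℝ → UnitAddTorus d → ℝ}

/-- The unforced case of `IsWeakNSSolutionForcedOn` is *exactly* the accepted G03 predicate
`Torus.IsWeakNSSolutionWithDataOn` (Temam, Ch. III §1.1; the force term `⟪0, ψ⟫` vanishes). [folklore] -/
@[simp]
theorem isWeakNSSolutionForcedOn_zero_iff :
    IsWeakNSSolutionForcedOn T ν 0 u₀ u ↔ FunctionSpaces.Torus.IsWeakNSSolutionWithDataOn T ν u₀ u := by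
  simp only [IsWeakNSSolutionForcedOn, FunctionSpaces.Torus.IsWeakNSSolutionWithDataOn, Pi.zero_apply,
    inner_zero_left, add_zero]

/-- A forced weak solution with datum is weakly divergence free for a.e. time (projection). [folklore] -/
theorem IsWeakNSSolutionForcedOn.ae_isWeaklyDivFree (h : IsWeakNSSolutionForcedOn T ν f u₀ u) :
    ∀ᵐ t ∂(volume.restrict (Ioo 0 T)), FunctionSpaces.Torus.IsWeaklyDivFree (u t) :=
  h.2.2.1

/-- A distributional (pressure-explicit) solution is a pressure-free weak solution on the open
time interval in the G03 sense when unforced: against divergence-free tests the pressure term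
`∫ p div ψ` vanishes pointwise in time (De Lellis–Székelyhidi 2009, §1; the G03 predicate
`Torus.IsWeakNSSolutionOn` is unforced, whence `f = 0`). [cite: LellisSzekelyhidi2009, §1] -/
theorem IsDistributionalNSSolutionOn.isWeakNSSolutionOn
    (h : IsDistributionalNSSolutionOn T ν 0 u p) : FunctionSpaces.Torus.IsWeakNSSolutionOn T ν u := by
  refine ⟨h.1, h.2.1, h.2.2.2.2.1, fun ψ hψ hdiv => ?_⟩
  have := h.2.2.2.2.2 ψ hψ
  simpa [hdiv _ _] using this

/-- **Classical solutions are forced weak solutions** on the torus: a classical solution on a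
time set `S ⊇ [0, T]` is a forced weak solution on `[0, T)` with datum `u 0` (pair the momentum
equation with a divergence-free test field and integrate by parts on `T^d`, where there are no
boundary terms, and in time; Temam, Ch. III §1.1; Leray 1934, §III). Forced twin of the accepted
`Torus.IsClassicalNSSolutionOn.isWeakNSSolutionOn`. [cite: Leray1934, §III] -/
def _root_.Literature.Analysis.FunctionSpaces.Torus.IsClassicalNSSolutionOn.isWeakNSSolutionForcedOn : Prop :=
  ∀ {S : Set ℝ} (h : FunctionSpaces.Torus.IsClassicalNSSolutionOn S ν f u p) (hS : Icc 0 T ⊆ S),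
    IsWeakNSSolutionForcedOn T ν f (u 0) u

/-- **Existence (recovery) of the pressure on the torus.** If `u` is a forced weak
(pressure-free) solution on `T^d × [0, T)` with `u ∈ L^{2q}_{t,x}` and `f ∈ L^q_{t,x}` for some
`q > 1` (and `f` measurable), then there is a pressure `p` (namely
`p = (−Δ)⁻¹ div div (u ⊗ u) − (−Δ)⁻¹ div f ∈ L^q_{t,x}`, by `L^q`-boundedness of the Riesz
transforms on `T^d`) such that `(u, p)` is a distributional solution against all vector tests
(de Rham's theorem / necessity of the pressure: Temam, Ch. I Prop. 1.1–1.2 and Ch. III §1.5;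
Robinson–Rodrigo–Sadowski 2016, Ch. 5). The integrability exponent `q > 1` ensures that `p` is a
function; for merely `L²` velocities the pressure is in general only a distribution. [cite: RobinsonRodrigoSadowski2016, Ch. 5] -/
def exists_pressure_of_isWeakNSSolutionForcedOn : Prop :=
  ∀ (h : IsWeakNSSolutionForcedOn T ν f u₀ u) {q : ℝ} (hq : 1 < q) (hu : ∫⁻ t in Ioo 0 T, ∫⁻ x, ‖u t x‖ₑ ^ (2 * q) < ∞) (hfm : AEStronglyMeasurable (FunctionSpaces.Torus.stLift f) (volume.restrict (Ioo 0 T ×ˢ univ))) (hf : ∫⁻ t in Ioo 0 T, ∫⁻ x, ‖f t x‖ₑ ^ q < ∞),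
    ∃ p : ℝ → UnitAddTorus d → ℝ, IsDistributionalNSSolutionOn T ν f u p

/-! **Torus-to-space bridge for weak solutions** (Fefferman, (8), (10)–(11): the periodic problems
are posed on `ℝⁿ`; Leray 1934, §31, (5.15)): a forced weak solution with datum on `T^d × [0, T)`
whose force has integrable slices for a.e. `t` and whose datum is integrable lifts to a
`ℤ^d`-periodic weak solution on `ℝ^d × [0, T)` in the sense of `IsWeakNSSolutionOn` — the proved
fact `Torus.IsWeakNSSolutionForcedOn.lift_of_integrable` of
`Literature/Analysis/FluidPDE/WeakSolutionLift.lean`. The version formerly stated here for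
arbitrary `f`, `u₀`, `Torus.IsWeakNSSolutionForcedOn.lift`, went beyond every source and was
retired; see the module docstring. -/

end Literature.Analysis.FluidPDE.Torus
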